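import Mathlib.Analysis.SpecialFunctions.Gamma.Basic
import Literature.MathematicalPhysics.QuantumManyBody.BoseEinsteinCondensation
import HarnessLib

/-!
# The one-component charged Bose gas (bosonic jellium) and Foldy's law

Topic `Literature/MathematicalPhysics/QuantumManyBody` (definition item `defn-JelliumBoseGas`,
cite item wi-14161). Over the vocabulary of
`Literature.MathematicalPhysics.QuantumManyBody.BoseGas` (`Space`, `Config`, `box`, `TrialState`,
`energy`, `maxOccupation`, `sideLength`; units `ħ = 2m = 1`, Dirichlet box `Λ_L = (0, L)³`) we
formalise the **one-component charged Bose gas** ("bosonic jellium") of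
[LSSY2005, Ch. 10, (10.1)]: `N` bosons of charge `e` (coupling `q = e² ≥ 0`) in `Λ_L` with a
uniform neutralising background of density `ρ_b`,
`H_N^{(1)} = ∑ᵢ (-Δᵢ - q ρ_b V_Λ(xᵢ)) + q ∑_{i<j} |xᵢ - xⱼ|⁻¹ + q C`,
`V_Λ(x) = ∫_Λ |x - y|⁻¹ dy`, `C = ½ ρ_b² ∬_{Λ×Λ} |x - y|⁻¹` (Dirichlet boundary conditions, loc. cit.),
optionally with an additional repulsive core `v` ("jellium-plus-core", as in route
BECJelliumComparison of the summit AtomisticToContinuum), and vendor **Foldy's law**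
[LSSY2005, Thm. 10.1] as a named fact.

## Main definitions (all `ℝ≥0∞`-valued, like `BoseGas.energy`)

* `backgroundPotential L x = ∫_{Λ_L} |x - y|⁻¹ dy` (`= V(x)/ρ` of (10.1)) and
  `backgroundSelfEnergy ρ_b L = ½ ρ_b² ∫_{Λ_L} backgroundPotential` (`= C` of (10.1) at unit charge).
* `jelliumInteraction ρ_b N L X = ∑_{i<j} ofReal |xᵢ - xⱼ|⁻¹ + ∑ᵢ ofReal (ρ_b (6πL² - V₁(xᵢ)))`,
  `V₁(x) = ∫_Λ |x - y|⁻¹ dy = backgroundPotential L x` (LSSY's `V = ρ_b V₁`) — the Coulomb energy of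
  the configuration at unit charge, with the particle–background attraction `-ρ_b V₁(xᵢ)` SHIFTED by
  the constant `6πL²ρ_b` per particle instead of by LSSY's `C`: since `V₁ ≤ 6πL²` on `Λ`
  (`Λ ⊂ B(x, √3 L)`, `∫_{B(x,R)} |x-y|⁻¹ dy = 2πR²`) each one-body term is `≥ 0` there, so nothing
  is clipped by `ENNReal.ofReal` where a trial state lives. This is VERBATIM the `let jel := …` of
  the items of route BECJelliumComparison (stmt-AtomisticToContinuum-5025…5028); on `Λ^N`,
  `jelliumInteraction = U - C + 6π ρ_b N L²` where `U = ∑_{i<j}|xᵢ-xⱼ|⁻¹ - ρ_b ∑ᵢ V₁(xᵢ) + C`,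
  `C = ½ ρ_b² ∫_Λ V₁ = backgroundSelfEnergy ρ_b L`, is the total Coulomb energy of (10.1) at unit
  charge.
* `chargedEnergy v q ρ_b Ψ = energy v Ψ + q ∫ jelliumInteraction · |Ψ|²` (verbatim `cE`),
  `chargedGroundStateEnergy v q ρ_b N L = inf_Ψ chargedEnergy` and
  `chargedCondensateNumber v q ρ_b N L` (verbatim `cN`: `condensateNumber` with `energy ↦
  chargedEnergy`).
* `jelliumEnergyShift q ρ_b N L = q (6π ρ_b N L² - backgroundSelfEnergy ρ_b L)` — the constant by
  which `chargedEnergy 0 q ρ_b Ψ` exceeds the quadratic form `⟨Ψ, H_N^{(1)} Ψ⟩` of LSSY's (10.1)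
  (with `μ = 1`, `e² = q`, `H_N^{(1)} = -∑Δᵢ + qU`), by the identity above and `‖Ψ‖₂ = 1`.
* `foldyConstant = (2/5) (Γ(3/4)/Γ(5/4)) (2/π)^{1/4} ≈ 0.48305` — the constant of (10.2) at `μ = 1`.
* `foldyLaw` — **named fact** [LSSY2005, Thm. 10.1]: for every `q > 0`, as `ρ → ∞`, the
  ground-state energy per particle of `H_N^{(1)}` in the thermodynamic limit is
  `-foldyConstant · q^{5/4} ρ^{1/4} (1 + o(1))`.

## Faithfulness notes

* **Units.** LSSY write `-μΔ` and unit charge; the tree's kinetic energy is `-Δ` (`μ = 1`) and we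
  carry the coupling `q = e²`. The dictionary is exact and involves no rescaling of space:
  `-∑Δᵢ + q U = q · (-(1/q) ∑Δᵢ + U) = q · H_LSSY(μ = 1/q)` on the same box with the same `N`, so
  (10.2), `lim_{ρ→∞} ρ^{-1/4} e₀(ρ) = -(2/5)(Γ(3/4)/Γ(5/4))(2/(μπ))^{1/4}` for every `μ > 0`, reads
  `lim_{ρ→∞} ρ^{-1/4} e₀(ρ, q) = -q (2/5)(Γ(3/4)/Γ(5/4))(2q/π)^{1/4} = -foldyConstant · q^{5/4}`.
* **Which `e₀`.** In [LSSY2005, (2.2)] `e₀(ρ) = lim_{L→∞} E₀(ρL³, L)/(ρL³)` is the energy PER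
  PARTICLE (in [Solovej2006, Thm. 1.1] `e(ρ)` is per volume, hence `ρ^{-5/4}` there); its existence
  for jellium with Dirichlet conditions is [LiebNarnhofer1975] ("We know from the work in [LN] that
  the thermodynamic limit `e₀(ρ)` defined as in (2.2) exists", [LSSY2005, §10.1]). We state the law
  along `N → ∞`, `L = (N/ρ)^{1/3}` (so `ρL³ = N` exactly) in the `ε`–`ρ₀`–"eventually in `N`" form,
  which follows from Thm. 10.1 together with the existence of the limit and does not itself assert
  more.
* **Constants cross-checked** (numerically, this seat): at `μ = ½` formula (10.2) gives `0.574447`,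
  equal to `0.40154 (4π/3)^{1/4}` of [LiebSolovej2001, Thm. 1.1] and to the integral
  `(2/π)^{3/4} ∫₀^∞ (1 + x⁴ - x²(x⁴+2)^{1/2}) dx` of [Solovej2006, (2)]; the Γ-function closed forms
  printed in the arXiv versions of those two papers differ from their own integrals by a factor `2`,
  so we follow (10.2). At `μ = 1`: `foldyConstant = 0.483051`.
* **Two-sided.** Thm. 10.1 combines the lower bound of [LiebSolovej2001] (with Errata 2002) and the
  upper bound of [Solovej2006]; [Foldy1961] is the original Bogoliubov computation.

## What is NOT here

* No proof of `foldyLaw` (two long papers plus the thermodynamic limit [LiebNarnhofer1975]).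
* Not the bound `backgroundPotential L x ≤ 6πL²` on the box (it is support item
  stmt-AtomisticToContinuum-5029 of route BECJelliumComparison, left to its prover), not the dilation
  covariance `(ρ_b, q, L) ↦ (ρ_b/s³, q/s, sL)` of `chargedCondensateNumber` (needs transport of trial
  states under scaling), not the two-component gas / Dyson's `N^{7/5}` law [LSSY2005, Thm. 10.2], not
  the grand-canonical formulation.
* Mathlib has no many-body Coulomb systems (searched `jellium`, `Coulomb` many-body, `Bogoliubov`):
  nothing to reuse beyond `BoseGas`.

## References

* [LSSY2005] E. H. Lieb, R. Seiringer, J. P. Solovej, J. Yngvason, *The Mathematics of the Bose Gas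
  and its Condensation* (2005): Ch. 2 (2.2) (p. 13 of the held copy); §10.1, (10.1), Thm. 10.1 with
  (10.2) (pp. 94–95).
* [LiebSolovej2001] E. H. Lieb, J. P. Solovej, CMP 217 (2001) 127–163, Thm. 1.1 and (1.1)–(1.5)
  (arXiv:cond-mat/0007425 pp. 3–5), §9; Errata CMP 225 (2002) 219–221.
* [Solovej2006] J. P. Solovej, CMP 266 (2006) 797–818, Thm. 1.1 with (1)–(2), §4
  (arXiv:math-ph/0406014 pp. 3, 12).
* [LiebNarnhofer1975] E. H. Lieb, H. Narnhofer, J. Stat. Phys. 12 (1975) 291–310.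
* [Foldy1961] L. L. Foldy, Phys. Rev. 124 (1961) 649–651.
-/

noncomputable section

open MeasureTheory Filter
open scoped ENNReal NNReal

namespace Literature.MathematicalPhysics.QuantumManyBody.JelliumBoseGas

open BoseGas

/-! ### The jellium energy functional -/

/-- The electrostatic potential at `x` of the uniform background of UNIT density filling the box
`Λ_L`: `V_Λ(x)/ρ = ∫_{Λ_L} |x - y|⁻¹ dy` (so LSSY's `V = ρ · backgroundPotential L`).
[cite: LSSY2005, Ch. 10 (10.1)] -/
def backgroundPotential (L : ℝ) (x : Space) : ℝ :=
  ∫ y in box L, ‖x - y‖⁻¹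

/-- The background self-energy `C = ½ ρ_b ∫_Λ V = ½ ρ_b² ∬_{Λ×Λ} |x - y|⁻¹ dx dy` of (10.1) at unit
charge, for background density `ρ_b` in the box `Λ_L`. [cite: LSSY2005, Ch. 10 (10.1)] -/
def backgroundSelfEnergy (ρb L : ℝ) : ℝ :=
  ρb ^ 2 / 2 * ∫ x in box L, backgroundPotential L x

/-- The (shifted) Coulomb energy at unit charge of the configuration `X = (x₁, …, x_N)` in the box
`Λ_L` with uniform background of density `ρ_b`:
`∑_{i<j} |xᵢ - xⱼ|⁻¹ + ∑ᵢ ρ_b (6πL² - ∫_Λ |xᵢ - y|⁻¹ dy)`, i.e. the particle–particle repulsion plus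
the particle–background attraction `-ρ_b V_Λ(xᵢ)` shifted by `6πL²ρ_b` per particle (which makes
each one-body term nonnegative on `Λ`, where `∫_Λ |x - y|⁻¹ dy ≤ 6πL²`); LSSY's constant `C` is NOT
included (see `jelliumEnergyShift`). Values in `ℝ≥0∞`; `|0|⁻¹ = 0` on the (null) coincidence set.
Verbatim the `jel` of route BECJelliumComparison. [cite: LSSY2005, Ch. 10 (10.1)] -/
def jelliumInteraction (ρb : ℝ) (N : ℕ) (L : ℝ) (X : Config N) : ℝ≥0∞ :=
  (∑ i : Fin N, ∑ j : Fin N with i < j, ENNReal.ofReal (‖X i - X j‖⁻¹)) +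
    ∑ i : Fin N, ENNReal.ofReal (ρb * (6 * Real.pi * L ^ 2 - ∫ y in box L, ‖X i - y‖⁻¹))

/-- The energy `⟨Ψ, (H_N[v] + q · jellium) Ψ⟩ ∈ [0, ∞]` of a trial state of the jellium-plus-core gas:
the `BoseGas.energy` of the core `v` (kinetic energy `∑|∇ᵢΨ|²` plus `∑_{i<j} v(|xᵢ-xⱼ|)`) plus
`q ∫ jelliumInteraction ρ_b · |Ψ|²`, `q = e²` the Coulomb coupling. For `v = 0` this is the
quadratic form of LSSY's `H_N^{(1)}` (10.1) (with `μ = 1`, charge² `= q`) plus the constant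
`jelliumEnergyShift q ρ_b N L`. Verbatim the `cE` of route BECJelliumComparison.
[cite: LSSY2005, Ch. 10 (10.1)] -/
def chargedEnergy {N : ℕ} {L : ℝ} (v : ℝ → ℝ≥0∞) (q ρb : ℝ) (Ψ : TrialState N L) : ℝ≥0∞ :=
  energy v Ψ + ENNReal.ofReal q * ∫⁻ X, jelliumInteraction ρb N L X * (‖Ψ.ψ X‖₊ : ℝ≥0∞) ^ 2

/-- The ground-state energy `inf_Ψ chargedEnergy v q ρ_b Ψ` of `N` charged bosons (core `v`,
coupling `q`, background density `ρ_b`) in the Dirichlet box `Λ_L` (`⊤` if `N = 0` or `L ≤ 0`).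
[cite: LSSY2005, Ch. 10 (10.1) and (2.2)] -/
def chargedGroundStateEnergy (v : ℝ → ℝ≥0∞) (q ρb : ℝ) (N : ℕ) (L : ℝ) : ℝ≥0∞ :=
  ⨅ Ψ : TrialState N L, chargedEnergy v q ρb Ψ

/-- The condensate occupation `λ_max(γ_{Ψ₀})` of the ground state of the charged gas, through
near-minimisers exactly as `BoseGas.condensateNumber` with `energy ↦ chargedEnergy`:
`sup_{δ>0} inf {λ_max(γ_Ψ) | chargedEnergy Ψ ≤ E₀ + δ}`. Verbatim the `cN` of route
BECJelliumComparison. [cite: LSSY2005, §1.2 (1.17)–(1.19) and Ch. 10] -/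
def chargedCondensateNumber (v : ℝ → ℝ≥0∞) (q ρb : ℝ) (N : ℕ) (L : ℝ) : ℝ≥0∞ :=
  ⨆ (δ : ℝ≥0∞) (_ : 0 < δ),
    ⨅ (Ψ : TrialState N L) (_ : chargedEnergy v q ρb Ψ ≤ chargedGroundStateEnergy v q ρb N L + δ),
      maxOccupation N Ψ.ψ

/-- The constant offset between the tree's functional and LSSY's Hamiltonian (10.1) with coupling
`q` and `μ = 1`: `chargedEnergy 0 q ρ_b Ψ = ⟨Ψ, H_N^{(1)} Ψ⟩ + jelliumEnergyShift q ρ_b N L`, where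
`jelliumEnergyShift q ρ_b N L = q (6π ρ_b N L² - C)`, `C = backgroundSelfEnergy ρ_b L`
(the shift `6πL²ρ_b` per particle was added, the constant `C` was not). [cite: LSSY2005, Ch. 10 (10.1)] -/
def jelliumEnergyShift (q ρb : ℝ) (N : ℕ) (L : ℝ) : ℝ :=
  q * (6 * Real.pi * ρb * N * L ^ 2 - backgroundSelfEnergy ρb L)

/-- **Foldy's constant** at `μ = 1` (units `ħ = 2m = 1`):
`(2/5) (Γ(3/4)/Γ(5/4)) (2/π)^{1/4} ≈ 0.483051`, the modulus of the right side of (10.2); at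
general `μ` the constant is `foldyConstant · μ^{-1/4}` (`0.574447 = 0.40154 (4π/3)^{1/4}` at
`μ = ½`, the normalisation of [LiebSolovej2001, Thm. 1.1]). [cite: LSSY2005, Thm. 10.1 (10.2)] -/
def foldyConstant : ℝ :=
  2 / 5 * (Real.Gamma (3 / 4) / Real.Gamma (5 / 4)) * (2 / Real.pi) ^ (1 / 4 : ℝ)

/-- **Foldy's law for the one-component charged Bose gas** [LSSY2005, Thm. 10.1 (10.2)]:
*`lim_{ρ→∞} ρ^{-1/4} e₀(ρ) = -(2/5) (Γ(3/4)/Γ(5/4)) (2/(μπ))^{1/4}`*, where `e₀(ρ)` is the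
thermodynamic limit (2.2) of the ground-state energy per particle of `H_N^{(1)}` (10.1) in the
Dirichlet box (its existence: [LiebNarnhofer1975]); the lower bound is [LiebSolovej2001, Thm. 1.1],
the upper bound [Solovej2006, Thm. 1.1]. In the tree's units (`μ = 1`, Coulomb coupling `q = e²`,
`H = -∑Δᵢ + qU = q · H_LSSY(μ = 1/q)`) and vocabulary: for every `q > 0` and `ε > 0` there is `ρ₀`
such that for every background density `ρ ≥ ρ₀`, for all sufficiently large `N`, with
`L = (N/ρ)^{1/3}`, the neutral jellium ground-state energy
`E₀(N, L) = chargedGroundStateEnergy 0 q ρ N L - jelliumEnergyShift q ρ N L` is finite and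
`|E₀(N, L)/N + foldyConstant · q^{5/4} ρ^{1/4}| ≤ ε ρ^{1/4}`. Named fact, not proved here.
[cite: LSSY2005, Thm. 10.1] -/
def foldyLaw : Prop :=
  ∀ q : ℝ, 0 < q → ∀ ε : ℝ, 0 < ε → ∃ ρ₀ : ℝ, 0 < ρ₀ ∧ ∀ ρ : ℝ, ρ₀ ≤ ρ →
    ∀ᶠ N : ℕ in atTop,
      chargedGroundStateEnergy 0 q ρ N (sideLength ρ N) ≠ ⊤ ∧
        |((chargedGroundStateEnergy 0 q ρ N (sideLength ρ N)).toReal -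
              jelliumEnergyShift q ρ N (sideLength ρ N)) / N +
            foldyConstant * q ^ (5 / 4 : ℝ) * ρ ^ (1 / 4 : ℝ)| ≤ ε * ρ ^ (1 / 4 : ℝ)

/-! ### Basic API -/

/-- `jelliumInteraction` written with `backgroundPotential`. [cite: LSSY2005, Ch. 10 (10.1)] -/
theorem jelliumInteraction_eq (ρb : ℝ) (N : ℕ) (L : ℝ) (X : Config N) :
    jelliumInteraction ρb N L X =
      (∑ i : Fin N, ∑ j : Fin N with i < j, ENNReal.ofReal (‖X i - X j‖⁻¹)) +
        ∑ i : Fin N, ENNReal.ofReal (ρb * (6 * Real.pi * L ^ 2 - backgroundPotential L (X i))) :=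
  rfl

/-- At zero coupling the charged energy is the neutral `BoseGas.energy`. [cite: LSSY2005, Ch. 10 (10.1)] -/
@[simp] theorem chargedEnergy_zero {N : ℕ} {L : ℝ} (v : ℝ → ℝ≥0∞) (ρb : ℝ) (Ψ : TrialState N L) :
    chargedEnergy v 0 ρb Ψ = energy v Ψ := by
  simp [chargedEnergy]

/-- At zero coupling the charged ground-state energy is `BoseGas.groundStateEnergy`.
[cite: LSSY2005, Ch. 10 (10.1)] -/
@[simp] theorem chargedGroundStateEnergy_zero (v : ℝ → ℝ≥0∞) (ρb : ℝ) (N : ℕ) (L : ℝ) :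
    chargedGroundStateEnergy v 0 ρb N L = groundStateEnergy v N L := by
  simp [chargedGroundStateEnergy, groundStateEnergy]

/-- **Consistency at `q = 0`:** the charged condensate number is `BoseGas.condensateNumber`.
[cite: LSSY2005, §1.2 (1.19)] -/
@[simp] theorem chargedCondensateNumber_zero (v : ℝ → ℝ≥0∞) (ρb : ℝ) (N : ℕ) (L : ℝ) :
    chargedCondensateNumber v 0 ρb N L = condensateNumber v N L := by
  simp [chargedCondensateNumber, condensateNumber]

/-- Variational principle: the charged ground-state energy is below the energy of every trial
state. [cite: LSSY2005, (2.3)] -/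
theorem chargedGroundStateEnergy_le_chargedEnergy {N : ℕ} {L : ℝ} (v : ℝ → ℝ≥0∞) (q ρb : ℝ)
    (Ψ : TrialState N L) : chargedGroundStateEnergy v q ρb N L ≤ chargedEnergy v q ρb Ψ :=
  iInf_le _ Ψ

/-- The charged energy dominates the neutral energy (the jellium term is nonnegative).
[cite: LSSY2005, Ch. 10 (10.1)] -/
theorem energy_le_chargedEnergy {N : ℕ} {L : ℝ} (v : ℝ → ℝ≥0∞) (q ρb : ℝ) (Ψ : TrialState N L) :
    energy v Ψ ≤ chargedEnergy v q ρb Ψ :=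
  le_self_add

/-- Every near-minimiser controls the charged condensate number from above at its own energy
slack. [cite: LSSY2005, §1.2] -/
theorem iInf_maxOccupation_le_charged {N : ℕ} {L : ℝ} (v : ℝ → ℝ≥0∞) (q ρb : ℝ) {δ : ℝ≥0∞}
    (Ψ : TrialState N L) (h : chargedEnergy v q ρb Ψ ≤ chargedGroundStateEnergy v q ρb N L + δ) :
    ⨅ (Φ : TrialState N L) (_ : chargedEnergy v q ρb Φ ≤ chargedGroundStateEnergy v q ρb N L + δ),
        maxOccupation N Φ.ψ ≤ maxOccupation N Ψ.ψ :=
  iInf₂_le Ψ h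

/-- A uniform lower bound on `λ_max` over all `δ`-near-minimisers of the charged energy, for some
`δ > 0`, bounds the charged condensate number from below (how BEC of the charged gas is to be
proved). [cite: LSSY2005, §1.2 (1.19)] -/
theorem le_chargedCondensateNumber {N : ℕ} {L : ℝ} (v : ℝ → ℝ≥0∞) (q ρb : ℝ) {δ m : ℝ≥0∞}
    (hδ : 0 < δ)
    (h : ∀ Ψ : TrialState N L, chargedEnergy v q ρb Ψ ≤ chargedGroundStateEnergy v q ρb N L + δ →
      m ≤ maxOccupation N Ψ.ψ) :
    m ≤ chargedCondensateNumber v q ρb N L :=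
  le_iSup₂_of_le (f := fun δ _ => ⨅ (Ψ : TrialState N L)
      (_ : chargedEnergy v q ρb Ψ ≤ chargedGroundStateEnergy v q ρb N L + δ), maxOccupation N Ψ.ψ)
    δ hδ (le_iInf₂ h)

/-- Foldy's constant is positive (so Foldy's law is a NEGATIVE correlation energy
`-foldyConstant · q^{5/4} ρ^{1/4}`). [cite: LSSY2005, Thm. 10.1 (10.2)] -/
theorem foldyConstant_pos : 0 < foldyConstant := by
  unfold foldyConstant
  have h1 : 0 < Real.Gamma (3 / 4) := Real.Gamma_pos_of_pos (by norm_num)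
  have h2 : 0 < Real.Gamma (5 / 4) := Real.Gamma_pos_of_pos (by norm_num)
  have h3 : 0 < (2 / Real.pi) ^ (1 / 4 : ℝ) := Real.rpow_pos_of_pos (by positivity) _
  positivity

end Literature.MathematicalPhysics.QuantumManyBody.JelliumBoseGas
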